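import Literature.NumberTheory.LocalFields.PadicOneUnitsModule
import Mathlib.GroupTheory.Index
import Mathlib.GroupTheory.OrderOfElement
import Mathlib.Topology.Algebra.OpenSubgroup
import HarnessLib

/-!
# Explicit neighbourhoods of `1` inside `ℚ_p^{*n}`: `U_{v_p(n)+1} ⊆ ℤ_pⁿ` (`p ≠ 2`), `U_{v_p(n)+2} ⊆ ℤ_pⁿ`;
# `Uⁿ` is open in `U = ℤ_p^×` and finite-index subgroups of `U` are open (Neukirch II §5 Ex. 4)

Topic `NumberTheory/LocalFields`; namespace `Literature.NumberTheory.LocalFields`. Everything here is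
proved (theorems only; no definitions, no named facts). Continues `PadicOneUnitsBinomialPowers.lean`
(Serre II §3.2 Prop. 8: `U₁ = (1 + p)^{ℤ_p}` for `p ≠ 2`, `U₂ = 5^{ℤ_2}`, isometrically:
`‖(1 + p)^α − 1‖ = ‖p‖·‖α‖`, `‖5^α − 1‖ = ‖4‖·‖α‖`) and `PadicOneUnitsModule.lean` (`(u^z)^k = u^{zk}`).

J. Neukirch, *Algebraic Number Theory*, Ch. II §5, Exercise 4 (held text p. 0135): "For a `p`-adic number
field `K`, every subgroup of finite index in `K^*` is both open and closed" — because `K^{*m}` contains a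
neighbourhood of `1`. For `K^* = ℚ_p^*` (indeed for every local field of characteristic `0`) that
statement and the openness of `K^{*n}` are ALREADY in the tree
(`GaloisRepresentations.isOpen_range_powMonoidHom_units`,
`GaloisRepresentations.Subgroup.isOpen_of_finiteIndex_units_localField`, via Hensel and the radius
`v(x − 1) < v(n²)`); they are not restated here. This file adds the EXPLICIT radii coming from Serre's
isometry `U₁ ≅ ℤ_p` (J.-P. Serre, *A Course in Arithmetic*, Ch. II §3.2 Prop. 8, §3.3: for `n = 2`,
`p ≠ 2`, "`U₁ ⊂ ℚ_p^{*2}`"; `p = 2`, "`U₃ ⊂ ℚ_2^{*2}`"), and the unit-group versions: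

* §1 `exists_pow_eq_of_norm_sub_one_le_of_ne_two` — `p ≠ 2`: `‖u − 1‖ ≤ ‖p‖·‖n‖`
  (`u ∈ U_{v_p(n)+1}`) implies `u = wⁿ`, `w ∈ ℤ_p` (`u = (1 + p)^α`, `‖α‖ ≤ ‖n‖`, `α = nβ`,
  `u = ((1 + p)^β)ⁿ`); `exists_pow_eq_of_norm_sub_one_le` — all `p`: `‖u − 1‖ ≤ ‖p‖²·‖n‖` suffices
  (for `p = 2` via `U₂ = 5^{ℤ_2}`); `mem_range_powMonoidHom_of_norm_sub_one_le` — the same ball of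
  `ℚ_p^*` lies in `ℚ_p^{*n}`;
* §2 `mem_range_powMonoidHom_padicInt_of_norm_sub_one_le`, `isOpen_range_powMonoidHom_units_padicInt` —
  `Uⁿ ⊇ U_{v_p(n)+2}` is open in `U = ℤ_p^×` (`n ≥ 1`);
* §3 `isOpen_units_padicInt_of_index_ne_zero` — a subgroup `H ≤ ℤ_p^×` of finite index `m` contains
  `Uᵐ`, hence is open and closed.

(`(ℚ_p^* : ℚ_p^{*n})` and `(U : Uⁿ)` are computed in `PadicPowerClassIndex.lean`; a one-unit is an
`n`-th power for every `n` prime to `p` by `PadicOneUnitRoots.lean`.)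

## References

* J.-P. Serre, *A Course in Arithmetic*, GTM 7, Springer 1973, Ch. II §3.2 Prop. 8, §3.3. [Serre1973]
* J. Neukirch, *Algebraic Number Theory*, Grundlehren 322, Springer 1999, Ch. II §5 Exercise 4.
  [NeukirchANT1999]
-/

noncomputable section

open Filter Topology

namespace Literature.NumberTheory.LocalFields

variable {p : ℕ} [hp : Fact p.Prime]

/-! ## §1. One-units close to `1` are `n`-th powers -/

/-- `‖(p : ℤ_p)‖ < 1`. [folklore] -/
private theorem norm_p_lt_one₃ : ‖(p : ℤ_[p])‖ < 1 := by
  rw [PadicInt.norm_p]; exact inv_lt_one_of_one_lt₀ (by exact_mod_cast hp.out.one_lt)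

/-- `‖α‖ ≤ ‖n‖ ↔ n ∣ α` in `ℤ_p` (`n = p^{v_p(n)}·m`, `m` a unit). [folklore] -/
private theorem norm_le_norm_natCast_iff_dvd {n : ℕ} (hn : n ≠ 0) (α : ℤ_[p]) :
    ‖α‖ ≤ ‖(n : ℤ_[p])‖ ↔ (n : ℤ_[p]) ∣ α := by
  have hm : IsUnit ((ordCompl[p] n : ℕ) : ℤ_[p]) := by
    rw [PadicInt.isUnit_iff, PadicInt.norm_natCast_eq_one_iff]
    exact (Nat.Prime.coprime_iff_not_dvd hp.out).2 (Nat.not_dvd_ordCompl hp.out hn)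
  conv => rw [← Nat.ordProj_mul_ordCompl_eq_self n p, Nat.cast_mul, Nat.cast_pow]
  rw [hm.mul_right_dvd, norm_mul, PadicInt.isUnit_iff.1 hm, mul_one, PadicInt.norm_p_pow,
    PadicInt.norm_le_pow_iff_mem_span_pow, Ideal.mem_span_singleton]

/-- `((1 + x)^β)ᵏ = (1 + x)^{βk}`. [folklore] -/
private theorem binomialPower_pow {x : ℤ_[p]} (hx : ‖x‖ < 1) (β : ℤ_[p]) (k : ℕ) :
    PadicInt.mahlerSeries (fun n => x ^ n) β ^ k =
      PadicInt.mahlerSeries (fun n => x ^ n) (β * (k : ℤ_[p])) := by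
  have h := oneUnitPow_pow (u := 1 + x) (by rwa [add_sub_cancel_left]) β k
  rwa [add_sub_cancel_left] at h

/-- The core: if `U_{‖x‖} = (1 + x)^{ℤ_p}` isometrically (`‖(1 + x)^α − 1‖ = ‖x‖·‖α‖`, Serre's
Prop. 8 for `x = p`, `p ≠ 2`, and for `x = 4`, `p = 2`), then every `u` with `‖u − 1‖ ≤ ‖x‖·‖n‖` is an
`n`-th power: `u = (1 + x)^α` with `‖α‖ ≤ ‖n‖`, i.e. `α = nβ`, so `u = ((1 + x)^β)ⁿ`.
[cite: Serre1973, Ch. II §3.2 Prop. 8 / §3.3] -/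
private theorem exists_pow_eq_of_norm_sub_one_le_aux {x : ℤ_[p]} (hx : ‖x‖ < 1) (hx0 : x ≠ 0)
    (hL : ∀ k : ℕ, ‖(1 + x) ^ k - 1‖ = ‖x‖ * ‖(k : ℤ_[p])‖) {n : ℕ} (hn : n ≠ 0) (u : ℤ_[p])
    (hu : ‖u - 1‖ ≤ ‖x‖ * ‖(n : ℤ_[p])‖) : ∃ w : ℤ_[p], w ^ n = u := by
  have hxpos : 0 < ‖x‖ := norm_pos_iff.2 hx0
  have hu' : ‖u - 1‖ ≤ ‖x‖ :=
    hu.trans (mul_le_of_le_one_right hxpos.le (PadicInt.norm_le_one _))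
  obtain ⟨α, hα, -⟩ := binomialPower_bijective hx hx0 hL u hu'
  have hαn : ‖α‖ ≤ ‖(n : ℤ_[p])‖ := by
    have h := norm_binomialPower_sub_one hx hL α
    rw [hα] at h
    exact le_of_mul_le_mul_left (h ▸ hu) hxpos
  obtain ⟨β, rfl⟩ := (norm_le_norm_natCast_iff_dvd hn α).1 hαn
  exact ⟨PadicInt.mahlerSeries (fun m => x ^ m) β, by rw [binomialPower_pow hx, mul_comm, hα]⟩

/-- **For `p ≠ 2`: `‖u − 1‖ ≤ ‖p‖·‖n‖` (i.e. `u ∈ U_{v_p(n)+1}`) implies `u ∈ ℤ_p^{n}`.**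
[cite: Serre1973, Ch. II §3.2 Prop. 8 / §3.3] [cite: NeukirchANT1999, Ch. II §5 Exercise 4] -/
theorem exists_pow_eq_of_norm_sub_one_le_of_ne_two (hp2 : p ≠ 2) {n : ℕ} (hn : n ≠ 0) (u : ℤ_[p])
    (hu : ‖u - 1‖ ≤ ‖(p : ℤ_[p])‖ * ‖(n : ℤ_[p])‖) : ∃ w : ℤ_[p], w ^ n = u :=
  exists_pow_eq_of_norm_sub_one_le_aux norm_p_lt_one₃ (by exact_mod_cast hp.out.ne_zero)
    (norm_one_add_pow_sub_one hp2) hn u hu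

/-- **For every `p`: `‖u − 1‖ ≤ ‖p‖²·‖n‖` (i.e. `u ∈ U_{v_p(n)+2}`) implies `u ∈ ℤ_p^{n}`** (for `p = 2`
via `U₂ = 5^{ℤ_2}`). [cite: Serre1973, Ch. II §3.2 Prop. 8 / §3.3] [cite: NeukirchANT1999, Ch. II §5 Exercise 4] -/
theorem exists_pow_eq_of_norm_sub_one_le {n : ℕ} (hn : n ≠ 0) (u : ℤ_[p])
    (hu : ‖u - 1‖ ≤ ‖(p : ℤ_[p])‖ ^ 2 * ‖(n : ℤ_[p])‖) : ∃ w : ℤ_[p], w ^ n = u := by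
  by_cases hp2 : p = 2
  · subst hp2
    have h4 : (4 : ℤ_[2]) = ((2 : ℕ) : ℤ_[2]) ^ 2 := by norm_num
    have h4lt : ‖(4 : ℤ_[2])‖ < 1 := by rw [h4, PadicInt.norm_p_pow]; norm_num
    refine exists_pow_eq_of_norm_sub_one_le_aux h4lt (by norm_num) (fun k => ?_) hn u ?_
    · rw [show (1 + 4 : ℤ_[2]) = 5 by norm_num]; exact norm_five_pow_sub_one k
    · rwa [h4, norm_pow]
  · refine exists_pow_eq_of_norm_sub_one_le_of_ne_two hp2 hn u (hu.trans ?_)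
    rw [sq, mul_assoc]
    exact mul_le_of_le_one_left (mul_nonneg (norm_nonneg _) (norm_nonneg _)) (PadicInt.norm_le_one _)

/-- `‖p‖²·‖n‖ < 1`. [folklore] -/
private theorem radius_lt_one (n : ℕ) : ‖(p : ℤ_[p])‖ ^ 2 * ‖(n : ℤ_[p])‖ < 1 :=
  lt_of_le_of_lt (mul_le_of_le_one_right (sq_nonneg _) (PadicInt.norm_le_one _))
    (pow_lt_one₀ (norm_nonneg _) norm_p_lt_one₃ two_ne_zero)

/-- **An element `y ∈ ℚ_p^*` with `‖y − 1‖ ≤ ‖p‖²·‖n‖` is an `n`-th power in `ℚ_p^*`** (so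
`ℚ_p^{*n} ⊇ U_{v_p(n)+2}`; openness of `ℚ_p^{*n}` itself is the tree's
`GaloisRepresentations.isOpen_range_powMonoidHom_units`). [cite: Serre1973, Ch. II §3.2 Prop. 8 / §3.3]
[cite: NeukirchANT1999, Ch. II §5 Exercise 4] -/
theorem mem_range_powMonoidHom_of_norm_sub_one_le {n : ℕ} (hn : n ≠ 0) (y : ℚ_[p]ˣ)
    (hy : ‖(y : ℚ_[p]) - 1‖ ≤ ‖(p : ℤ_[p])‖ ^ 2 * ‖(n : ℤ_[p])‖) :
    y ∈ (powMonoidHom n : ℚ_[p]ˣ →* ℚ_[p]ˣ).range := by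
  have hy1 : ‖(y : ℚ_[p]) - 1‖ < 1 := hy.trans_lt (radius_lt_one n)
  have hnorm : ‖(y : ℚ_[p])‖ = 1 := by
    have h := Padic.add_eq_max_of_ne (q := (y : ℚ_[p]) - 1) (r := 1) (by rw [norm_one]; exact hy1.ne)
    rwa [sub_add_cancel, norm_one, max_eq_right hy1.le] at h
  set u : ℤ_[p] := ⟨(y : ℚ_[p]), hnorm.le⟩ with hu
  have hu1 : ‖u - 1‖ ≤ ‖(p : ℤ_[p])‖ ^ 2 * ‖(n : ℤ_[p])‖ := by
    rw [PadicInt.norm_def, PadicInt.coe_sub, PadicInt.coe_one]; exact hy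
  obtain ⟨w, hw⟩ := exists_pow_eq_of_norm_sub_one_le hn u hu1
  have hu0 : u ≠ 0 := fun h => y.ne_zero (congrArg Subtype.val h)
  have hw0 : (w : ℚ_[p]) ≠ 0 := by
    refine PadicInt.coe_ne_zero.2 fun h => hu0 ?_
    rw [← hw, h, zero_pow hn]
  refine ⟨Units.mk0 (w : ℚ_[p]) hw0, Units.ext ?_⟩
  rw [powMonoidHom_apply, Units.val_pow_eq_pow_val, Units.val_mk0, ← PadicInt.coe_pow, hw]

/-! ## §2. `Uⁿ` is open in `U = ℤ_p^×` -/

/-- A unit `y ∈ ℤ_p^×` with `‖y − 1‖ ≤ ‖p‖²·‖n‖` is an `n`-th power in `ℤ_p^×`.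
[cite: NeukirchANT1999, Ch. II §5 Exercise 4] -/
theorem mem_range_powMonoidHom_padicInt_of_norm_sub_one_le {n : ℕ} (hn : n ≠ 0) (y : ℤ_[p]ˣ)
    (hy : ‖(y : ℤ_[p]) - 1‖ ≤ ‖(p : ℤ_[p])‖ ^ 2 * ‖(n : ℤ_[p])‖) :
    y ∈ (powMonoidHom n : ℤ_[p]ˣ →* ℤ_[p]ˣ).range := by
  obtain ⟨w, hw⟩ := exists_pow_eq_of_norm_sub_one_le hn (y : ℤ_[p]) hy
  have hwu : IsUnit w := (isUnit_pow_iff hn).1 (hw ▸ y.isUnit)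
  refine ⟨hwu.unit, Units.ext ?_⟩
  rw [powMonoidHom_apply, Units.val_pow_eq_pow_val, hwu.unit_spec, hw]

/-- **`Uⁿ` is open in `U = ℤ_p^×`** (`n ≥ 1`). [cite: NeukirchANT1999, Ch. II §5 Exercise 4] -/
theorem isOpen_range_powMonoidHom_units_padicInt {n : ℕ} (hn : n ≠ 0) :
    IsOpen ((powMonoidHom n : ℤ_[p]ˣ →* ℤ_[p]ˣ).range : Set ℤ_[p]ˣ) := by
  set r : ℝ := ‖(p : ℤ_[p])‖ ^ 2 * ‖(n : ℤ_[p])‖ with hr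
  have hrpos : 0 < r := mul_pos (pow_pos (norm_pos_iff.2 (by exact_mod_cast hp.out.ne_zero)) 2)
    (norm_pos_iff.2 (by exact_mod_cast hn))
  refine Subgroup.isOpen_of_mem_nhds _ (g := 1) ?_
  have hO : IsOpen {y : ℤ_[p]ˣ | ‖(y : ℤ_[p]) - 1‖ < r} :=
    isOpen_lt (continuous_norm.comp (Units.continuous_val.sub continuous_const)) continuous_const
  refine mem_of_superset (hO.mem_nhds (by simp [hrpos])) fun y hy => ?_
  exact mem_range_powMonoidHom_padicInt_of_norm_sub_one_le hn y (le_of_lt hy)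

/-! ## §3. Subgroups of finite index of `ℤ_p^×` are open and closed -/

/-- **Every subgroup of finite index of `U = ℤ_p^×` is open and closed**: if `(U : H) = m < ∞` then
`Uᵐ ≤ H` and `Uᵐ` is open. (For `ℚ_p^*` itself — indeed for any local field of characteristic `0` —
this is the tree's `GaloisRepresentations.Subgroup.isOpen_of_finiteIndex_units_localField`.)
[cite: NeukirchANT1999, Ch. II §5 Exercise 4] -/
theorem isOpen_units_padicInt_of_index_ne_zero (H : Subgroup ℤ_[p]ˣ) (hH : H.index ≠ 0) :
    IsOpen (H : Set ℤ_[p]ˣ) ∧ IsClosed (H : Set ℤ_[p]ˣ) := by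
  have hle : (powMonoidHom H.index : ℤ_[p]ˣ →* ℤ_[p]ˣ).range ≤ H := by
    rintro _ ⟨y, rfl⟩
    exact H.pow_index_mem y
  have hO : IsOpen (H : Set ℤ_[p]ˣ) := Subgroup.isOpen_of_mem_nhds _ (g := 1)
    (mem_of_superset ((isOpen_range_powMonoidHom_units_padicInt hH).mem_nhds (one_mem _)) hle)
  exact ⟨hO, H.isClosed_of_isOpen hO⟩

end Literature.NumberTheory.LocalFields
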